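import Mathlib

/-!
# Route `NashClassCertificates`, crux `NashNearField` (stmt-AtomisticToContinuum-16827), line `birth`:
# pieces for the stub `stub_localSmoothCertificateOfCauchyBorn` (CBBC ⇒ LSC), III — gauge change of the
# first-order transfer (reference-mismatch bookkeeping)

The exact first-order transfer `τ i j = ½⟪k(y i − y j), u i + u j⟫` of pieces I (`stub_linAddTransfer`) needs a
GAUGE: the displacement `u` from the reference, which is only locally small when the flatness charts of the local
smooth certificate drift (rotate) across the region.  Changing the gauge by a field `c` (re-centring the reference
chart from site to site) changes the outgoing transfer sum at `i` by the work of the reference bond-force sum against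
`c i` plus HALF THE PAIRING OF THE BOND FORCES WITH THE GAUGE INCREMENTS:

* `stub_transferGaugeChange` — `Σ_{j∈Ω} ½⟪k_ij, (u i + c i) + (u j + c j)⟫
   = Σ_{j∈Ω} ½⟪k_ij, u i + u j⟫ + ⟪F_i, c i⟫ + ½ Σ_{j∈Ω∖i} ⟪k_ij, c j − c i⟫` (`k` odd, `k_ij = k(y i − y j)`,
   `F_i = Σ_{j∈Ω∖i} k_ij`);
* `stub_affineGaugeStress` — for an affine gauge increment `c j − c i = A (y j − y i)` the last term is
  `−½ Σ_{j∈Ω∖i} ⟪k_ij, A (y i − y j)⟫ = −½ P_i : A`, the site virial (first Piola) stress of the reference paired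
  with `A`.

So patching local gauges costs `stress × gauge gradient`: zero at force-balanced, STRESS-FREE references, and of
size `|P(G_i)|·|∇c| ≲ dist(G_i, optimal cell)·ν` in general — absorbed by AM–GM between the Cauchy–Born landscape
excess `≥ c·dist²` and `C_R ν²` (worker audit B2_audit.md, wave 4 note).  All `[folklore]` finite-sum identities.
-/

noncomputable section

open scoped BigOperators RealInnerProductSpace

namespace Summit.AtomisticToContinuum.Crystallization.Theorems.NashClassCertificatesNashNearField

/-- **Stub piece `stub_transferGaugeChange`: gauge change of the first-order transfer (proved).**  For an odd bond map
`k`, a region `Ω ∋ i`, a reference `y`, a gauge `u` and a gauge change `c`: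
`Σ_{j∈Ω} ½⟪k(y i − y j), (u i + c i) + (u j + c j)⟫ = Σ_{j∈Ω} ½⟪k(y i − y j), u i + u j⟫ + ⟪Σ_{j∈Ω∖i} k(y i − y j), c i⟫
 + ½ Σ_{j∈Ω∖i} ⟪k(y i − y j), c j − c i⟫` (the `j = i` terms vanish, `k 0 = 0`). [folklore] -/
theorem stub_transferGaugeChange :
    ∀ (N : ℕ) (k : EuclideanSpace ℝ (Fin 3) → EuclideanSpace ℝ (Fin 3)), (∀ v, k (-v) = -k v) →
      ∀ (Ω : Finset (Fin N)) (y u c : Fin N → EuclideanSpace ℝ (Fin 3)) (i : Fin N), i ∈ Ω →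
        ∑ j ∈ Ω, (1 / 2 : ℝ) * inner ℝ (k (y i - y j)) ((u i + c i) + (u j + c j)) =
          (∑ j ∈ Ω, (1 / 2 : ℝ) * inner ℝ (k (y i - y j)) (u i + u j)) +
            inner ℝ (∑ j ∈ Ω.erase i, k (y i - y j)) (c i) +
            (1 / 2 : ℝ) * ∑ j ∈ Ω.erase i, inner ℝ (k (y i - y j)) (c j - c i) := by
  intro N k hk Ω y u c i hi
  have hk0 : k 0 = 0 := by
    have h := hk 0
    rw [neg_zero] at h
    have h2 : (2 : ℝ) • k 0 = 0 := by
      rw [two_smul]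
      nth_rewrite 2 [h]
      exact add_neg_cancel (k 0)
    exact (smul_eq_zero.1 h2).resolve_left two_ne_zero
  -- split off the `j = i` terms (they vanish) and compare termwise on `Ω ∖ i`
  rw [← Finset.add_sum_erase Ω _ hi, ← Finset.add_sum_erase Ω (fun j => (1 / 2 : ℝ) * inner ℝ (k (y i - y j)) (u i + u j)) hi]
  simp only [sub_self, hk0, inner_zero_left, mul_zero, zero_add]
  rw [sum_inner, Finset.mul_sum, ← Finset.sum_add_distrib, ← Finset.sum_add_distrib]
  refine Finset.sum_congr rfl fun j _ => ?_
  rw [inner_add_right, inner_add_right, inner_add_right, inner_add_right, inner_sub_right]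
  ring

/-- **Stub piece `stub_affineGaugeStress`: affine gauge increments pair with the reference stress (proved).**  If the
gauge change is affine along the reference on `Ω ∖ i`, `c j − c i = A (y j − y i)`, then
`½ Σ_{j∈Ω∖i} ⟪k(y i − y j), c j − c i⟫ = −½ Σ_{j∈Ω∖i} ⟪k(y i − y j), A (y i − y j)⟫` — minus one half of the site
virial stress `P_i = Σ_j k(y i − y j) ⊗ (y i − y j)` of the reference paired with `A`; it vanishes at stress-free
references (and for skew `A` at any reference with central bond forces `k(v) ∥ v`). [folklore] -/
theorem stub_affineGaugeStress :
    ∀ (N : ℕ) (k : EuclideanSpace ℝ (Fin 3) → EuclideanSpace ℝ (Fin 3)) (Ω : Finset (Fin N))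
      (y c : Fin N → EuclideanSpace ℝ (Fin 3)) (A : EuclideanSpace ℝ (Fin 3) →L[ℝ] EuclideanSpace ℝ (Fin 3))
      (i : Fin N), (∀ j ∈ Ω.erase i, c j - c i = A (y j - y i)) →
        (1 / 2 : ℝ) * ∑ j ∈ Ω.erase i, inner ℝ (k (y i - y j)) (c j - c i) =
          -((1 / 2 : ℝ) * ∑ j ∈ Ω.erase i, inner ℝ (k (y i - y j)) (A (y i - y j))) := by
  intro N k Ω y c A i hA
  rw [← mul_neg, ← Finset.sum_neg_distrib]
  congr 1
  refine Finset.sum_congr rfl fun j hj => ?_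
  rw [hA j hj, show y j - y i = -(y i - y j) by abel, map_neg, inner_neg_right]

end Summit.AtomisticToContinuum.Crystallization.Theorems.NashClassCertificatesNashNearField

end
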